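import Summits.Ventures.HSemireg.WedgeHankelRecurrenceGaussChebyshevResultantGapTwo

/-!
# Venture HSemireg — **COMMON ZEROS OF `T_{n+2}`, `T_n` AND OF `U_{n+2}`, `U_n`** (Mathlib's Chebyshev polynomials): consecutive `T_{n+1}`, `T_n` (and `U_{n+1}`, `U_n`) never share a zero in a
# nontrivial commutative ring; `T_{2m}(0) = ±1 ≠ 0`; over a field with `2 ≠ 0`, **`T_{n+2}` and `T_n` have a common zero iff `n` is odd** (the zero `0`), likewise for `U`; and over `ℤ`
# **`Res_{(n+2,n)}(T_{n+2}, T_n) = 0 ⟺ n odd`**, **`Res_{(n+2,n)}(U_{n+2}, U_n) = 0 ⟺ n odd`** (N430)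

HONEST FRAMING. Part of the Lean index of the computation cell `pub-hsemireg` (seat p10 gen 47, Sunday typer «UNIFORM-IN-n»).  Polynomial evaluation and integer algebra only (Mathlib
`Polynomial.Chebyshev`, `Polynomial.resultant`); no variety, no cohomology theory, no sheaf, no Ext group and no semiregularity map is constructed here; nothing here says that HC / HC_CM / HC_AV
holds; no Literature fact (unproved `Prop`) is declared or used.  Custodian versions as in `WedgeHankelSiegelIdeal` (1/3).
SOURCES (cited).  G. Szegő, *Orthogonal Polynomials*, §3.3 (consecutive orthogonal polynomials have no common zero), (4.7.4) ∕ (1.12.3) (`T_n(0)`); P. C. Gibson, *Common zeros of two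
polynomials in an orthogonal sequence*, J. Approx. Theory 105 (2000) 129–132; K. Dilcher, K. B. Stolarsky, Trans. Amer. Math. Soc. 357 (2005) 965–981 (vanishing of `Res(T_m, T_n)`).  The
parity criteria are COROLLARIES typed here.
PROOF TYPED HERE.  Descent `T_n = 2X T_{n+1} − T_{n+2}` down to `T_0 = 1`; `2x T_{n+1}(x) = T_{n+2}(x) + T_n(x)`; Mathlib `T_eval_two_mul_zero` (`= ±1`), `T_eval_zero_of_odd`; N430
`chebyshevT_resultant_gap_two`, `chebyshevU_resultant_gap_two`.
DEDUP DISCLOSURE (`rg -n -i 'chebyshev.*common_zero|eval_ne_zero_of_eval_succ|not_isRoot_chebyshevT' Summits Literature`, 2026-09-04): N427 (abstract symmetric recurrences, Hermite);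
`Literature.Algebra.Polynomial.ChebyshevCoefficientFormulas.not_isRoot_chebyshevT_succ` (consecutive `T`, `ℤ`-indexed, `IsRoot` form — the RELATED statement to the first lemma below, which is
kept in the `ℕ`-indexed `eval` form used by the gap-two criteria) and `isCoprime_chebyshevT_succ` ∕ `isCoprime_chebyshevU_succ_nat`; 0 hits for the 8 names below.

WHAT IS IN THE TREE.  N430 `chebyshevT_resultant_gap_two`, `chebyshevU_resultant_gap_two`; N427 `common_zero_gap_two_iff_odd` (abstract); Mathlib `T_add_two`, `U_add_two`, `T_zero`, `U_zero`,
`T_eval_two_mul_zero`, `U_eval_two_mul_zero`, `T_eval_zero_of_odd`, `U_eval_zero_of_odd`, `Int.units_eq_one_or`.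
THIS FILE (namespace `Summit.Ventures.HSemireg.Wedge.HankelOuter` continued; CHAINED on N430; 0 definitions):
* §1196 `chebyshevT_eval_ne_zero_of_eval_succ_eq_zero`, `chebyshevU_eval_ne_zero_of_eval_succ_eq_zero` (consecutive members share no zero), `chebyshevT_eval_zero_ne_zero_of_even`,
  `chebyshevU_eval_zero_ne_zero_of_even`, **`chebyshevT_common_zero_gap_two_iff`**, **`chebyshevU_common_zero_gap_two_iff`** (field, `2 ≠ 0`),
  **`chebyshevT_resultant_gap_two_eq_zero_iff`**, **`chebyshevU_resultant_gap_two_eq_zero_iff`** (over `ℤ`).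
CAVEATS.  The field criteria assume `(2 : K) ≠ 0` (in characteristic `2` one has `T_{n+2} = T_n`, not treated).  Nothing Ext-side.  New names only.
-/

open Module Polynomial
open scoped Matrix Polynomial

namespace Summit.Ventures.HSemireg.Wedge.HankelOuter

/-! ## §1196. Common zeros two steps apart in the Chebyshev families -/

/-- **Consecutive `T_{n+1}`, `T_n` have no common zero** (nontrivial commutative ring): `T_{n+1}(x) = 0 ⇒ T_n(x) ≠ 0`. [Szegő §3.3; this file, §1196] -/
theorem chebyshevT_eval_ne_zero_of_eval_succ_eq_zero {R : Type*} [CommRing R] [Nontrivial R] (x : R) :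
    ∀ n : ℕ, (Polynomial.Chebyshev.T R ((n : ℤ) + 1)).eval x = 0 → (Polynomial.Chebyshev.T R (n : ℤ)).eval x ≠ 0 := by
  intro n
  induction n with
  | zero => intro _; rw [Nat.cast_zero, Polynomial.Chebyshev.T_zero, eval_one]; exact one_ne_zero
  | succ n ih =>
    intro h1 h2
    push_cast at h1 h2
    have e : Polynomial.Chebyshev.T R (n : ℤ) = 2 * Polynomial.X * Polynomial.Chebyshev.T R ((n : ℤ) + 1) - Polynomial.Chebyshev.T R ((n : ℤ) + 1 + 1) := by
      rw [show (n : ℤ) + 1 + 1 = (n : ℤ) + 2 by ring, Polynomial.Chebyshev.T_add_two]; ring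
    have h3 : (Polynomial.Chebyshev.T R (n : ℤ)).eval x = 0 := by rw [e, eval_sub, h1, sub_zero, eval_mul, h2, mul_zero]
    exact ih h2 h3

/-- **Consecutive `U_{n+1}`, `U_n` have no common zero** (nontrivial commutative ring). [Szegő §3.3; this file, §1196] -/
theorem chebyshevU_eval_ne_zero_of_eval_succ_eq_zero {R : Type*} [CommRing R] [Nontrivial R] (x : R) :
    ∀ n : ℕ, (Polynomial.Chebyshev.U R ((n : ℤ) + 1)).eval x = 0 → (Polynomial.Chebyshev.U R (n : ℤ)).eval x ≠ 0 := by
  intro n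
  induction n with
  | zero => intro _; rw [Nat.cast_zero, Polynomial.Chebyshev.U_zero, eval_one]; exact one_ne_zero
  | succ n ih =>
    intro h1 h2
    push_cast at h1 h2
    have e : Polynomial.Chebyshev.U R (n : ℤ) = 2 * Polynomial.X * Polynomial.Chebyshev.U R ((n : ℤ) + 1) - Polynomial.Chebyshev.U R ((n : ℤ) + 1 + 1) := by
      rw [show (n : ℤ) + 1 + 1 = (n : ℤ) + 2 by ring, Polynomial.Chebyshev.U_add_two]; ring
    have h3 : (Polynomial.Chebyshev.U R (n : ℤ)).eval x = 0 := by rw [e, eval_sub, h1, sub_zero, eval_mul, h2, mul_zero]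
    exact ih h2 h3

/-- `T_n(0) ≠ 0` for even `n` (it is `±1`). [Szegő (1.12.3); this file, §1196] -/
theorem chebyshevT_eval_zero_ne_zero_of_even {R : Type*} [CommRing R] [Nontrivial R] (n : ℕ) (hn : Even n) :
    (Polynomial.Chebyshev.T R (n : ℤ)).eval 0 ≠ 0 := by
  obtain ⟨m, rfl⟩ := hn
  rw [show ((m + m : ℕ) : ℤ) = 2 * (m : ℤ) by push_cast; ring, Polynomial.Chebyshev.T_eval_two_mul_zero]
  rcases Int.units_eq_one_or ((m : ℤ).negOnePow) with h | h <;> rw [h]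
  · rw [Units.val_one, Int.cast_one]; exact one_ne_zero
  · rw [Units.val_neg, Units.val_one, Int.cast_neg, Int.cast_one, neg_ne_zero]; exact one_ne_zero

/-- `U_n(0) ≠ 0` for even `n` (it is `±1`). [Szegő (1.12.3); this file, §1196] -/
theorem chebyshevU_eval_zero_ne_zero_of_even {R : Type*} [CommRing R] [Nontrivial R] (n : ℕ) (hn : Even n) :
    (Polynomial.Chebyshev.U R (n : ℤ)).eval 0 ≠ 0 := by
  obtain ⟨m, rfl⟩ := hn
  rw [show ((m + m : ℕ) : ℤ) = 2 * (m : ℤ) by push_cast; ring, Polynomial.Chebyshev.U_eval_two_mul_zero]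
  rcases Int.units_eq_one_or ((m : ℤ).negOnePow) with h | h <;> rw [h]
  · rw [Units.val_one, Int.cast_one]; exact one_ne_zero
  · rw [Units.val_neg, Units.val_one, Int.cast_neg, Int.cast_one, neg_ne_zero]; exact one_ne_zero

/-- **`T_{n+2}` and `T_n` have a common zero iff `n` is odd** (field with `2 ≠ 0`; the common zero is `0`). [corollary; Gibson 2000; Szegő §3.3; this file, §1196] -/
theorem chebyshevT_common_zero_gap_two_iff {K : Type*} [Field K] (h2 : (2 : K) ≠ 0) (n : ℕ) :
    (∃ x : K, (Polynomial.Chebyshev.T K ((n : ℤ) + 2)).eval x = 0 ∧ (Polynomial.Chebyshev.T K (n : ℤ)).eval x = 0) ↔ Odd n := by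
  constructor
  · rintro ⟨x, ha, hb⟩
    have hT1 : (Polynomial.Chebyshev.T K ((n : ℤ) + 1)).eval x ≠ 0 := by
      have h := chebyshevT_eval_ne_zero_of_eval_succ_eq_zero x (n + 1)
      push_cast at h
      exact h (by rw [show (n : ℤ) + 1 + 1 = (n : ℤ) + 2 by ring]; exact ha)
    have e := congrArg (Polynomial.eval x) (Polynomial.Chebyshev.T_add_two K (n : ℤ))
    rw [ha, eval_sub, hb, sub_zero, eval_mul, eval_mul, eval_X, eval_ofNat] at e
    have hx : x = 0 := by
      rcases mul_eq_zero.1 e.symm with h | h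
      · rcases mul_eq_zero.1 h with h' | h'
        · exact absurd h' h2
        · exact h'
      · exact absurd h hT1
    subst hx
    by_contra hne
    exact chebyshevT_eval_zero_ne_zero_of_even (R := K) n (Nat.not_odd_iff_even.1 hne) hb
  · rintro ⟨m, rfl⟩
    exact ⟨0, Polynomial.Chebyshev.T_eval_zero_of_odd (R := K) ⟨m + 1, by push_cast; ring⟩, Polynomial.Chebyshev.T_eval_zero_of_odd (R := K) ⟨m, by push_cast; ring⟩⟩

/-- **`U_{n+2}` and `U_n` have a common zero iff `n` is odd** (field with `2 ≠ 0`; the common zero is `0`). [corollary; Gibson 2000; Szegő §3.3; this file, §1196] -/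
theorem chebyshevU_common_zero_gap_two_iff {K : Type*} [Field K] (h2 : (2 : K) ≠ 0) (n : ℕ) :
    (∃ x : K, (Polynomial.Chebyshev.U K ((n : ℤ) + 2)).eval x = 0 ∧ (Polynomial.Chebyshev.U K (n : ℤ)).eval x = 0) ↔ Odd n := by
  constructor
  · rintro ⟨x, ha, hb⟩
    have hU1 : (Polynomial.Chebyshev.U K ((n : ℤ) + 1)).eval x ≠ 0 := by
      have h := chebyshevU_eval_ne_zero_of_eval_succ_eq_zero x (n + 1)
      push_cast at h
      exact h (by rw [show (n : ℤ) + 1 + 1 = (n : ℤ) + 2 by ring]; exact ha)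
    have e := congrArg (Polynomial.eval x) (Polynomial.Chebyshev.U_add_two K (n : ℤ))
    rw [ha, eval_sub, hb, sub_zero, eval_mul, eval_mul, eval_X, eval_ofNat] at e
    have hx : x = 0 := by
      rcases mul_eq_zero.1 e.symm with h | h
      · rcases mul_eq_zero.1 h with h' | h'
        · exact absurd h' h2
        · exact h'
      · exact absurd h hU1
    subst hx
    by_contra hne
    exact chebyshevU_eval_zero_ne_zero_of_even (R := K) n (Nat.not_odd_iff_even.1 hne) hb
  · rintro ⟨m, rfl⟩
    exact ⟨0, Polynomial.Chebyshev.U_eval_zero_of_odd (R := K) ⟨m + 1, by push_cast; ring⟩, Polynomial.Chebyshev.U_eval_zero_of_odd (R := K) ⟨m, by push_cast; ring⟩⟩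

/-- **`Res_{(n+2,n)}(T_{n+2}, T_n) = 0 ⟺ n` odd** (over `ℤ`). [corollary of N430; Dilcher–Stolarsky 2005; this file, §1196] -/
theorem chebyshevT_resultant_gap_two_eq_zero_iff (n : ℕ) :
    (Polynomial.Chebyshev.T ℤ ((n : ℤ) + 2)).resultant (Polynomial.Chebyshev.T ℤ (n : ℤ)) (n + 2) n = 0 ↔ Odd n := by
  rw [chebyshevT_resultant_gap_two]
  constructor
  · intro h
    by_contra hne
    exact absurd h (mul_ne_zero (mul_ne_zero (pow_ne_zero _ two_ne_zero) (chebyshevT_eval_zero_ne_zero_of_even n (Nat.not_odd_iff_even.1 hne)))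
      (mul_ne_zero (pow_ne_zero _ (neg_ne_zero.2 one_ne_zero)) (pow_ne_zero _ two_ne_zero)))
  · rintro ⟨m, rfl⟩
    rw [Polynomial.Chebyshev.T_eval_zero_of_odd (R := ℤ) ⟨m, by push_cast; ring⟩, mul_zero, zero_mul]

/-- **`Res_{(n+2,n)}(U_{n+2}, U_n) = 0 ⟺ n` odd** (over `ℤ`). [corollary of N430; Dilcher–Stolarsky 2005; this file, §1196] -/
theorem chebyshevU_resultant_gap_two_eq_zero_iff (n : ℕ) :
    (Polynomial.Chebyshev.U ℤ ((n : ℤ) + 2)).resultant (Polynomial.Chebyshev.U ℤ (n : ℤ)) (n + 2) n = 0 ↔ Odd n := by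
  rw [chebyshevU_resultant_gap_two]
  constructor
  · intro h
    by_contra hne
    exact absurd h (mul_ne_zero (mul_ne_zero (pow_ne_zero _ two_ne_zero) (chebyshevU_eval_zero_ne_zero_of_even n (Nat.not_odd_iff_even.1 hne)))
      (mul_ne_zero (pow_ne_zero _ (neg_ne_zero.2 one_ne_zero)) (pow_ne_zero _ two_ne_zero)))
  · rintro ⟨m, rfl⟩
    rw [Polynomial.Chebyshev.U_eval_zero_of_odd (R := ℤ) ⟨m, by push_cast; ring⟩, mul_zero, zero_mul]

end Summit.Ventures.HSemireg.Wedge.HankelOuter
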